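import Summits.CriticalPhenomena.PercolationContinuityZ3.Theorems.PercNearOneGluingNoHeavyLowerTailAntitheticPairCertificate
import HarnessLib

/-!
# `NoHeavyLowerTail` (stmt-CriticalPhenomena-4575) — antithetic cluster pairs: explicit small red-dominated PAIR CUBES (prim-hp-2 gen 58)

Support file (`--supports stmt-CriticalPhenomena-4575`, hull-port prover `prim-hp-2`, gen 58).  No definitions, no named facts, no sorries;
standard axioms.  The pieces of a pair-level 𝒦⁺-certificate (HOME/MEMO-gen56 §2, MEMO-gen58 §4 P3'), stated for EXPLICIT points so that a
certificate produced by the LP (kit `cglp`) can be checked by `decide` on set inclusions and `native_decide` on the cover equation (as in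
…AntitheticCherryOplus), without sums over `Set ι`:

* (the 1-cube and 0-cube versions are `Antithetic.Cherry.one_cube_nonneg` / `zero_cube_nonneg` in …AntitheticCherryOplus.)
* `Antithetic.Cube.two_nonneg`: a red-dominated 2-CUBE = four points `a ≼ b ≼ d`, `a ≼ c ≼ d` with ANTIPODAL domination for the pairs
  `(a,d)` and `(b,c)`; for twisted-monotone super-odd `K₁, K₂`: `K₁K₂(a) + K₁K₂(b) + K₁K₂(c) + K₁K₂(d) ≥ 0`.  Proof = Harris on `{0,1}²`
  by two Chebyshev steps (rows, then row sums), the antipodal sums being `≥ 0`.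
* `Antithetic.Cube.harris_square`: the underlying inequality `4 Σ u v ≥ (Σ u)(Σ v)` for functions increasing on the square.
[cite: VandenbergHaggstromKahn2005, §1 p. 6 ("Harris' inequality")]
-/

noncomputable section

namespace Summit.CriticalPhenomena.PercolationContinuityZ3.Theorems

namespace Antithetic

namespace Cube

variable {V : Type*}

/-- Harris on the square `{0,1}²` (two Chebyshev steps): `u, v` increasing along the four edges `a→b, a→c, b→d, c→d` satisfy
`4 (uₐvₐ + u_bv_b + u_cv_c + u_dv_d) ≥ (Σ u)(Σ v)`. [folklore] -/
theorem harris_square (ua ub uc ud va vb vc vd : ℝ) (hu1 : ua ≤ ub) (hu2 : ua ≤ uc) (hu3 : ub ≤ ud) (hu4 : uc ≤ ud)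
    (hv1 : va ≤ vb) (hv2 : va ≤ vc) (hv3 : vb ≤ vd) (hv4 : vc ≤ vd) :
    (ua + ub + uc + ud) * (va + vb + vc + vd) ≤ 4 * (ua * va + ub * vb + uc * vc + ud * vd) := by
  -- rows {a,b} and {c,d}: Chebyshev; then Chebyshev on the row sums (increasing: a ≤ c, b ≤ d)
  have r1 : (ua + ub) * (va + vb) ≤ 2 * (ua * va + ub * vb) := by nlinarith [mul_nonneg (sub_nonneg.2 hu1) (sub_nonneg.2 hv1)]
  have r2 : (uc + ud) * (vc + vd) ≤ 2 * (uc * vc + ud * vd) := by nlinarith [mul_nonneg (sub_nonneg.2 hu4) (sub_nonneg.2 hv4)]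
  have hs : ua + ub ≤ uc + ud := by linarith
  have ht : va + vb ≤ vc + vd := by linarith
  have r3 : (ua + ub + (uc + ud)) * (va + vb + (vc + vd)) ≤ 2 * ((ua + ub) * (va + vb) + (uc + ud) * (vc + vd)) := by
    nlinarith [mul_nonneg (sub_nonneg.2 hs) (sub_nonneg.2 ht)]
  nlinarith [r1, r2, r3]

/-- **Red-dominated 2-cube.**  Points `a = (Pa,Qa) ≼ b, c ≼ d` (twisted order: first slot grows, second shrinks) with antipodal domination
`Qd ⊆ Pa, Qa ⊆ Pd` and `Qc ⊆ Pb, Qb ⊆ Pc`; `K₁, K₂` twisted-monotone and super-odd.  Then the four-point sum of `K₁K₂` is `≥ 0`.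
[this work] -/
theorem two_nonneg (Pa Qa Pb Qb Pc Qc Pd Qd : Set V)
    (hab : Pa ⊆ Pb ∧ Qb ⊆ Qa) (hac : Pa ⊆ Pc ∧ Qc ⊆ Qa) (hbd : Pb ⊆ Pd ∧ Qd ⊆ Qb) (hcd : Pc ⊆ Pd ∧ Qd ⊆ Qc)
    (had : Qd ⊆ Pa ∧ Qa ⊆ Pd) (hbc : Qc ⊆ Pb ∧ Qb ⊆ Pc)
    {K₁ K₂ : Set V → Set V → ℝ}
    (hK₁ : ∀ ⦃A A' B B' : Set V⦄, A ⊆ A' → B' ⊆ B → K₁ A B ≤ K₁ A' B') (hso₁ : ∀ A B, 0 ≤ K₁ A B + K₁ B A)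
    (hK₂ : ∀ ⦃A A' B B' : Set V⦄, A ⊆ A' → B' ⊆ B → K₂ A B ≤ K₂ A' B') (hso₂ : ∀ A B, 0 ≤ K₂ A B + K₂ B A) :
    0 ≤ K₁ Pa Qa * K₂ Pa Qa + K₁ Pb Qb * K₂ Pb Qb + K₁ Pc Qc * K₂ Pc Qc + K₁ Pd Qd * K₂ Pd Qd := by
  -- monotonicity along the edges
  have u1 : K₁ Pa Qa ≤ K₁ Pb Qb := hK₁ hab.1 hab.2
  have u2 : K₁ Pa Qa ≤ K₁ Pc Qc := hK₁ hac.1 hac.2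
  have u3 : K₁ Pb Qb ≤ K₁ Pd Qd := hK₁ hbd.1 hbd.2
  have u4 : K₁ Pc Qc ≤ K₁ Pd Qd := hK₁ hcd.1 hcd.2
  have v1 : K₂ Pa Qa ≤ K₂ Pb Qb := hK₂ hab.1 hab.2
  have v2 : K₂ Pa Qa ≤ K₂ Pc Qc := hK₂ hac.1 hac.2
  have v3 : K₂ Pb Qb ≤ K₂ Pd Qd := hK₂ hbd.1 hbd.2
  have v4 : K₂ Pc Qc ≤ K₂ Pd Qd := hK₂ hcd.1 hcd.2
  -- antipodal domination + super-oddness: the antipodal sums are nonnegative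
  have s1 : 0 ≤ K₁ Pa Qa + K₁ Pd Qd := by
    have h := hK₁ had.2 had.1   -- K₁ Qa Pa ≤ K₁ Pd Qd
    have h' := hso₁ Pa Qa
    linarith
  have s2 : 0 ≤ K₁ Pb Qb + K₁ Pc Qc := by
    have h := hK₁ hbc.2 hbc.1   -- K₁ Qb Pb ≤ K₁ Pc Qc
    have h' := hso₁ Pb Qb
    linarith
  have t1 : 0 ≤ K₂ Pa Qa + K₂ Pd Qd := by
    have h := hK₂ had.2 had.1
    have h' := hso₂ Pa Qa
    linarith
  have t2 : 0 ≤ K₂ Pb Qb + K₂ Pc Qc := by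
    have h := hK₂ hbc.2 hbc.1
    have h' := hso₂ Pb Qb
    linarith
  have hH := harris_square _ _ _ _ _ _ _ _ u1 u2 u3 u4 v1 v2 v3 v4
  have hsum : 0 ≤ (K₁ Pa Qa + K₁ Pb Qb + K₁ Pc Qc + K₁ Pd Qd) * (K₂ Pa Qa + K₂ Pb Qb + K₂ Pc Qc + K₂ Pd Qd) :=
    mul_nonneg (by linarith) (by linarith)
  linarith

end Cube

end Antithetic

end Summit.CriticalPhenomena.PercolationContinuityZ3.Theorems
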